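import Summits.BirchSwinnertonDyer.Rank2.IntModelNodeRootCriterion
import Summits.BirchSwinnertonDyer.BirchSwinnertonDyer.Theorems.ManinLocalTwoThreeShimuraFiveFamilyRootNumber
import Literature.NumberTheory.DiophantineGeometry.LocalReductionFiniteBadPlacesProofs
import Mathlib.Tactic.LinearCombination
import HarnessLib

/-!
# Manin `c = ±1`, local two/three programme — road ε for E-es-228: the reduction types of the
# two-parameter split-`5` family `K′(m,n)` (T-es-97, row E-es-243 `SplitFiveFamilyReduction`)

Cell `bsd-f2-manin`, es lens (gen 44), `--supports stmt-BirchSwinnertonDyer-22967` (crux C2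
`ManinOddAtFour`; road ε = E-es-228 `ShimuraFiveSquarefreeOnlyAtEleven` modulo Carayol alone,
MEMO-es §68, CANDIDATES R-es-171).

For integers `m, n` let `K′(m,n)` be Vélu's quotient curve
`Literature.NumberTheory.EllipticCurves.KubertTateVelu.kubertTateFive' m n`
(`[n − m, −mn, −mn², 5mn³ − 10m²n² − 5m³n, mn⁵ − 15m²n⁴ + 5m³n³ − 10m⁴n² − m⁵n]`,
`Δ = mn(m² − 11mn − n²)⁵`); with `m = U⁵, n = V⁵` it is the integral model of the
`5Cs.1.1`-fibre `veluFive ((U/V)⁵)` (§2).  This file proves, at a finite place `v` of `ℤ` over the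
prime `p`:

* §1 (`c₄`: tree `kubertTateFive'_c₄`) the identity
  `c₄ = 5⁵m²n² + (m² − 11mn − n²)(m² + 239mn − n²)` and the node constant
  `54b₆ − 3b₂b₄ + a₂c₄ = mn·G(m,n)`;
* §2 the pure scaling `K′(m,n) = (u = n⁻¹) • veluFive (m/n)`, so `K′(U⁵,V⁵) ⊗ ℚ ≅ veluFive ((U/V)⁵)`;
* §3 (F4) `p ∤ mn(m² − 11mn − n²)` ⟹ good reduction; (F2) `p ∣ m² − 11mn − n²`, `p ∤ 5⁵m²n²` ⟹
  multiplicative reduction; (F1) `gcd(m,n) = 1`, `p ∣ mn` ⟹ SPLIT multiplicative reduction (the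
  node-tangent quadratic `c₄T² + a₁c₄T − mn·G` has the root `T = 0` modulo `p`; tree criterion
  `Summit.BirchSwinnertonDyer.Rank2.hasSplitMultiplicativeReductionAt_int_iff_exists_root`), hence
  local root number `w_p = −1`.

THEOREMS ONLY; no `sorry`; standard axioms.  Printed mathematics, new formal proofs; no
beyond-print theorem; BSD is not proved here; C2/C3 stay OPEN ⟸ CDT.
References: J. Vélu, C. R. Acad. Sci. Paris 273 (1971) [Velu1971]; J. H. Silverman, *AEC* (2009)
VII.5 Prop. 5.1 [SilvermanAEC2009]; D. Rohrlich, Compositio Math. 87 (1993) Prop. 2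
[Rohrlich1993Compositio]; D. Byeon, T. Kim, Acta Arith. 165 (2014) §3 [ByeonKim2014].
-/

set_option linter.dupNamespace false

noncomputable section

open IsDedekindDomain IsDedekindDomain.HeightOneSpectrum WeierstrassCurve Rat.HeightOneSpectrum
  Literature.NumberTheory.EllipticCurves Literature.NumberTheory.EllipticCurves.KubertTateVelu
open Summit.BirchSwinnertonDyer.Rank1Residual.ManinAdditive.EsG43 (veluFive)

namespace Summit.BirchSwinnertonDyer.BirchSwinnertonDyer.Theorems.ManinLocalTwoThree.ShimuraFive

/-! ### §1. Invariants of `K′(m,n)` -/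

section Invariants

variable {R : Type*} [CommRing R] (m n : R)

/-- `c₄(K′(m,n)) = 5⁵·m²n² + (m² − 11mn − n²)(m² + 239mn − n²)` (tree `kubertTateFive'_c₄`): away
from `5mn`, a prime of the norm factor `m² − 11mn − n²` does not divide `c₄`.
[cite: Velu1971, formulae] -/
theorem kubertTateFive'_c₄_eq_add_mul : (kubertTateFive' m n).c₄ =
    3125 * m ^ 2 * n ^ 2 + (m ^ 2 - 11 * m * n - n ^ 2) * (m ^ 2 + 239 * m * n - n ^ 2) := by
  rw [kubertTateFive'_c₄]; ring

/-- The constant term of the node-tangent quadratic of `K′(m,n)`: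
`54b₆ − 3b₂b₄ + a₂c₄ = mn·(−187m⁴ − 2511m³n + 247m²n² − 2739mn³ + 188n⁴)`, divisible by `mn`.
[cite: SilvermanAEC2009, VII.5 Prop. 5.1(b)] -/
theorem kubertTateFive'_nodal_const :
    54 * (kubertTateFive' m n).b₆ - 3 * (kubertTateFive' m n).b₂ * (kubertTateFive' m n).b₄ +
        (kubertTateFive' m n).a₂ * (kubertTateFive' m n).c₄ =
      m * n * (-187 * m ^ 4 - 2511 * m ^ 3 * n + 247 * m ^ 2 * n ^ 2 - 2739 * m * n ^ 3
        + 188 * n ^ 4) := by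
  simp only [kubertTateFive', b₂, b₄, b₆, c₄]; ring

end Invariants

/-! ### §2. The scaling to `veluFive` -/

/-- `K′(m,n) = (u = n⁻¹) • veluFive (m/n)` over `ℚ` (tree `smul_veluFive`: `aᵢ ↦ nⁱaᵢ`).
[cite: SilvermanAEC2009, III.1 Table 3.1] -/
theorem kubertTateFive'_eq_smul_veluFive (m n : ℚ) (hn : n ≠ 0) :
    kubertTateFive' m n = (⟨(Units.mk0 n hn)⁻¹, 0, 0, 0⟩ : VariableChange ℚ) • veluFive (m / n) := by
  rw [smul_veluFive, div_mul_cancel₀ m hn]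

/-- The `5Cs.1.1`-fibre at `s = U/V` is `ℚ`-isomorphic to the integer model `K′(U⁵, V⁵)`:
`K′(U⁵,V⁵) ⊗ ℚ = (u = V⁻⁵) • veluFive ((U/V)⁵)` (tree `baseChange_kubertTateFive'_int`).
[cite: SilvermanAEC2009, III.1 Table 3.1] -/
theorem baseChange_kubertTateFive'_pow_five_eq_smul_veluFive (U V : ℤ) (hV : V ≠ 0) :
    (kubertTateFive' (U ^ 5) (V ^ 5)).baseChange ℚ =
      (⟨(Units.mk0 ((V : ℚ) ^ 5) (pow_ne_zero 5 (Int.cast_ne_zero.mpr hV)))⁻¹, 0, 0, 0⟩ :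
          VariableChange ℚ) • veluFive (((U : ℚ) / V) ^ 5) := by
  rw [baseChange_kubertTateFive'_int, div_pow]
  push_cast
  exact kubertTateFive'_eq_smul_veluFive _ _ _

/-! ### §3. Reduction types of `K′(m,n) ⊗ ℚ` at a finite place of `ℤ` -/

section Reduction

variable {m n : ℤ} (v : HeightOneSpectrum ℤ)

/-- **(F4) Good reduction away from `Δ = mn(m² − 11mn − n²)⁵`.**
[cite: SilvermanAEC2009, VII.5 Prop. 5.1(a)] -/
theorem hasGoodReductionAt_kubertTateFive' [((kubertTateFive' m n).baseChange ℚ).IsElliptic]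
    (h : ¬ (natGenerator v : ℤ) ∣ m * n * (m ^ 2 - 11 * m * n - n ^ 2) ^ 5) :
    ((kubertTateFive' m n).baseChange ℚ).HasGoodReductionAt v := by
  refine hasGoodReductionAt_of_valuation_Δ_eq_one_holds v _ (isIntegralAt_baseChange_int v _) ?_
  rw [baseChange_int_Δ, kubertTateFive'_Δ]
  exact (Rat.valuation_intCast_eq_one_iff v _).mpr h

/-- **(F2) Multiplicative reduction at the primes of the norm factor**: `p ∣ m² − 11mn − n²` and
`p ∤ 5⁵m²n²` give `v(c₄) = 0 < v(Δ)`. [cite: SilvermanAEC2009, VII.5 Prop. 5.1(b)] -/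
theorem hasMultiplicativeReductionAt_kubertTateFive'_of_dvd_norm
    [((kubertTateFive' m n).baseChange ℚ).IsElliptic]
    (hg : (natGenerator v : ℤ) ∣ m ^ 2 - 11 * m * n - n ^ 2)
    (h5 : ¬ (natGenerator v : ℤ) ∣ 3125 * m ^ 2 * n ^ 2) :
    ((kubertTateFive' m n).baseChange ℚ).HasMultiplicativeReductionAt v := by
  refine hasMultiplicativeReductionAt_of_valuation_c₄_eq_one (isIntegralAt_baseChange_int v _) ?_ ?_
  · rw [baseChange_int_c₄, kubertTateFive'_c₄_eq_add_mul]
    exact (Rat.valuation_intCast_eq_one_iff v _).mpr fun h =>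
      h5 ((dvd_add_left (hg.mul_right _)).mp h)
  · rw [baseChange_int_Δ, kubertTateFive'_Δ]
    exact (Rat.valuation_intCast_lt_one_iff v _).mpr ((dvd_pow hg (by norm_num)).mul_left _)

/-- For coprime `m, n` and `p ∣ mn`: `p ∤ c₄(K′(m,n))` (`c₄ ≡ n⁴ (mod m)`, `c₄ ≡ m⁴ (mod n)`).
[cite: Velu1971, formulae] -/
theorem not_dvd_kubertTateFive'_c₄_of_dvd (hmn : IsCoprime m n) {p : ℕ} (hp : p.Prime)
    (hpmn : (p : ℤ) ∣ m * n) : ¬ (p : ℤ) ∣ (kubertTateFive' m n).c₄ := by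
  have hpZ : Prime (p : ℤ) := Nat.prime_iff_prime_int.mp hp
  have hunit : ¬ ((p : ℤ) ∣ m ∧ (p : ℤ) ∣ n) := by
    rintro ⟨hm, hn⟩
    have hu := hmn.isUnit_of_dvd' hm hn
    rw [Int.isUnit_iff] at hu
    have := hp.two_le
    omega
  rw [kubertTateFive'_c₄]
  intro h
  rcases hpZ.dvd_or_dvd hpmn with hm | hn
  · refine hunit ⟨hm, hpZ.dvd_of_dvd_pow (n := 4) ?_⟩
    have e : n ^ 4 = (m ^ 4 + 228 * m ^ 3 * n + 494 * m ^ 2 * n ^ 2 - 228 * m * n ^ 3 + n ^ 4)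
        - m * (m ^ 3 + 228 * m ^ 2 * n + 494 * m * n ^ 2 - 228 * n ^ 3) := by ring
    rw [e]
    exact dvd_sub h (hm.mul_right _)
  · refine hunit ⟨hpZ.dvd_of_dvd_pow (n := 4) ?_, hn⟩
    have e : m ^ 4 = (m ^ 4 + 228 * m ^ 3 * n + 494 * m ^ 2 * n ^ 2 - 228 * m * n ^ 3 + n ^ 4)
        - n * (228 * m ^ 3 + 494 * m ^ 2 * n - 228 * m * n ^ 2 + n ^ 3) := by ring
    rw [e]
    exact dvd_sub h (hn.mul_right _)

/-- **(F1) SPLIT multiplicative reduction at the primes of `mn`** (`gcd(m,n) = 1`): `p ∣ Δ`,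
`p ∤ c₄`, and the node-tangent quadratic `c₄T² + a₁c₄T − (54b₆ − 3b₂b₄ + a₂c₄)` has the root
`T = 0` modulo `p` because its constant term is `mn·G(m,n)`.
[cite: SilvermanAEC2009, VII.5 Prop. 5.1(b)] -/
theorem hasSplitMultiplicativeReductionAt_kubertTateFive'_of_dvd
    [((kubertTateFive' m n).baseChange ℚ).IsElliptic] (hmn : IsCoprime m n)
    (hpmn : (natGenerator v : ℤ) ∣ m * n) :
    ((kubertTateFive' m n).baseChange ℚ).HasSplitMultiplicativeReductionAt v := by
  have hΔ : (natGenerator v : ℤ) ∣ (kubertTateFive' m n).Δ := by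
    rw [kubertTateFive'_Δ]; exact hpmn.mul_right _
  have hc₄ : ¬ (natGenerator v : ℤ) ∣ (kubertTateFive' m n).c₄ :=
    not_dvd_kubertTateFive'_c₄_of_dvd hmn (prime_natGenerator v) hpmn
  refine (Rank2.hasSplitMultiplicativeReductionAt_int_iff_exists_root _ v hΔ hc₄).mpr ⟨0, ?_⟩
  rw [kubertTateFive'_nodal_const]
  have e : (kubertTateFive' m n).c₄ * (0 : ℤ) ^ 2 + (kubertTateFive' m n).a₁ *
        (kubertTateFive' m n).c₄ * 0 -
      m * n * (-187 * m ^ 4 - 2511 * m ^ 3 * n + 247 * m ^ 2 * n ^ 2 - 2739 * m * n ^ 3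
        + 188 * n ^ 4) =
      m * n * (187 * m ^ 4 + 2511 * m ^ 3 * n - 247 * m ^ 2 * n ^ 2 + 2739 * m * n ^ 3
        - 188 * n ^ 4) := by ring
  rw [e]
  exact hpmn.mul_right _

/-- **(F1′) Multiplicative reduction at the primes of `mn`** (from F1).
[cite: SilvermanAEC2009, VII.5 Prop. 5.1(b)] -/
theorem hasMultiplicativeReductionAt_kubertTateFive'_of_dvd
    [((kubertTateFive' m n).baseChange ℚ).IsElliptic] (hmn : IsCoprime m n)
    (hpmn : (natGenerator v : ℤ) ∣ m * n) :
    ((kubertTateFive' m n).baseChange ℚ).HasMultiplicativeReductionAt v :=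
  (hasSplitMultiplicativeReductionAt_kubertTateFive'_of_dvd v hmn hpmn).hasMultiplicativeReductionAt

/-- **Root number `w_p = −1` at the primes of `mn`** (`gcd(m,n) = 1`; Rohrlich: split
multiplicative ⟹ `w_v = −1`). [cite: Rohrlich1993Compositio, Prop. 2(ii)] -/
theorem localRootNumberAt_kubertTateFive'_of_dvd
    [((kubertTateFive' m n).baseChange ℚ).IsElliptic] (hmn : IsCoprime m n)
    (hpmn : (natGenerator v : ℤ) ∣ m * n) :
    ((kubertTateFive' m n).baseChange ℚ).localRootNumberAt v = -1 :=
  localRootNumberAt_of_hasSplitMultiplicativeReductionAt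
    (hasSplitMultiplicativeReductionAt_kubertTateFive'_of_dvd v hmn hpmn)

end Reduction

end Summit.BirchSwinnertonDyer.BirchSwinnertonDyer.Theorems.ManinLocalTwoThree.ShimuraFive
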